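import Mathlib
import Literature.NumberTheory.LFunctions.LiouvilleSumClassicalBound
import HarnessLib

/-!
# Crux `MobiusLadder.LiouvilleOrthogonalTC0` (stmt-QuantumAdvantage-1393), line `Sketch`, v8.1 (Möbius bridge):
stubs `stub_lamOfMu`, `stub_muOfLam`, `stub_sqTail` — `λ = μ ∗ 𝟙_□`, `μ = λ ∗ (μ on square roots)`, and the tail count of large square divisors

Three elementary finite identities / bounds used to transfer orthogonality between the Liouville
function `λ` and the Möbius function `μ`:

* `stub_lamOfMu`  : `λ(N) = ∑_{d² ∣ N} μ(N/d²)` (`N ≥ 1`), from `ζ ⋆ λ = 𝟙_□` and `ζ ⋆ μ = δ`;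
* `stub_muOfLam`  : `μ(N) = ∑_{d² ∣ N} μ(d) λ(N/d²)` (`N ≥ 1`), by Möbius inversion of the first
  identity along the lattice of square divisors (write `N = q s²`, `q` squarefree; the square
  divisors of `q m²` are the `d²` with `d ∣ m`);
* `stub_sqTail`   : `∑_{N < 2ⁿ} #{d > D₀ : d ∣ N, d² ∣ N} ≤ 2ⁿ / D₀`, by swapping the double count
  and `∑_{d > D₀} 1/d² ≤ 1/D₀`.
-/

set_option linter.dupNamespace false -- D-0017: single-problem summit ⇒ `QuantumAdvantage.QuantumAdvantage` by design

noncomputable section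

namespace Summit.QuantumAdvantage.QuantumAdvantage.Theorems.LiouvilleOrthogonalTC0

open Filter Finset
open scoped ArithmeticFunction.Moebius ArithmeticFunction.zeta

/-- The square divisors of `N ≠ 0`, as the image of `d ↦ d·d` on `{d ∈ N.divisors | d·d ∣ N}`. -/
theorem sqId_divisors_filter_isSquare (N : ℕ) (hN : N ≠ 0) :
    N.divisors.filter IsSquare =
      (N.divisors.filter (fun d => d * d ∣ N)).image (fun d => d * d) := by
  ext a
  simp only [mem_filter, mem_image, Nat.mem_divisors]
  constructor
  · rintro ⟨⟨ha, -⟩, r, rfl⟩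
    exact ⟨r, ⟨⟨(dvd_mul_right r r).trans ha, hN⟩, ha⟩, rfl⟩
  · rintro ⟨d, ⟨-, hd⟩, rfl⟩
    exact ⟨⟨hd, hN⟩, d, rfl⟩

/-- **`λ = 𝟙_□ ⋆ μ` pointwise**: for `N ≥ 1`, `λ(N) = ∑_{d² ∣ N} μ(N/d²)`, the sum running over the
`d ∈ N.divisors` with `d·d ∣ N` (from `ζ ⋆ λ = 𝟙_□`, `LiouvilleSum.sum_divisors_liouville`, and
`ζ ⋆ μ = δ`). -/
theorem stub_lamOfMu (N : ℕ) (hN : N ≠ 0) : (ArithmeticFunction.liouville N : ℤ) = ∑ d ∈ N.divisors.filter (fun d => d * d ∣ N), (ArithmeticFunction.moebius (N / (d * d)) : ℤ) := by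
  have h : (ArithmeticFunction.liouville : ArithmeticFunction ℤ) =
      (ζ * ArithmeticFunction.liouville) * μ := by
    rw [mul_right_comm, ArithmeticFunction.coe_zeta_mul_moebius, one_mul]
  conv_lhs => rw [h]
  rw [ArithmeticFunction.mul_apply, Nat.sum_divisorsAntidiagonal
    (f := fun a b => ((ζ : ArithmeticFunction ℤ) * ArithmeticFunction.liouville) a * μ b)]
  have key : ∀ i ∈ N.divisors,
      ((ζ : ArithmeticFunction ℤ) * ArithmeticFunction.liouville) i * μ (N / i) =
        if IsSquare i then μ (N / i) else 0 := by
    intro i hi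
    rw [ArithmeticFunction.coe_zeta_mul_apply,
      Literature.NumberTheory.LFunctions.LiouvilleSum.sum_divisors_liouville
        (Nat.pos_of_mem_divisors hi).ne']
    split_ifs <;> simp
  rw [sum_congr rfl key, ← sum_filter, sqId_divisors_filter_isSquare N hN, sum_image]
  intro x _ y _ hxy
  exact Nat.mul_self_inj.mp hxy

/-- For `q` squarefree and `n ≠ 0`, the `d ∈ (q·n²).divisors` with `d·d ∣ q·n²` are exactly the
divisors of `n`. -/
theorem sqId_filter_sq_dvd_eq_divisors {q n : ℕ} (hq : Squarefree q) (hn : n ≠ 0) :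
    (q * n ^ 2).divisors.filter (fun d => d * d ∣ q * n ^ 2) = n.divisors := by
  have hq0 : q ≠ 0 := hq.ne_zero
  have hqn : q * n ^ 2 ≠ 0 := mul_ne_zero hq0 (pow_ne_zero 2 hn)
  ext d
  simp only [mem_filter, Nat.mem_divisors]
  constructor
  · rintro ⟨⟨-, -⟩, hd⟩
    refine ⟨?_, hn⟩
    have hd0 : d ≠ 0 := by
      rintro rfl
      exact hqn (by simpa using hd)
    rw [← Nat.factorization_le_iff_dvd hd0 hn]
    have h1 := (Nat.factorization_le_iff_dvd (mul_ne_zero hd0 hd0) hqn).mpr hd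
    rw [Finsupp.le_def] at h1 ⊢
    intro p
    have h2 := h1 p
    simp only [Nat.factorization_mul hd0 hd0, Nat.factorization_mul hq0 (pow_ne_zero 2 hn),
      Nat.factorization_pow, Finsupp.add_apply, Finsupp.smul_apply, smul_eq_mul] at h2
    have h3 := hq.natFactorization_le_one p
    omega
  · rintro ⟨hd, -⟩
    have : d * d ∣ q * n ^ 2 := Dvd.dvd.mul_left (by rw [sq]; exact Nat.mul_dvd_mul hd hd) q
    exact ⟨⟨(dvd_mul_right d d).trans this, hqn⟩, this⟩

/-- **`μ = λ ⋆ (μ ∘ √)` pointwise**: for `N ≥ 1`, `μ(N) = ∑_{d² ∣ N} μ(d) λ(N/d²)`, the sum running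
over the `d ∈ N.divisors` with `d·d ∣ N`.  Proof: write `N = q·s²` with `q` squarefree; by
`stub_lamOfMu` and `sqId_filter_sq_dvd_eq_divisors`, `m ↦ λ(q m²)` is the divisor sum of
`m ↦ μ(q m²)`, and Möbius inversion (`ArithmeticFunction.sum_eq_iff_sum_mul_moebius_eq`) at `m = s`
is the claim. -/
theorem stub_muOfLam (N : ℕ) (hN : N ≠ 0) : (ArithmeticFunction.moebius N : ℤ) = ∑ d ∈ N.divisors.filter (fun d => d * d ∣ N), (ArithmeticFunction.moebius d : ℤ) * ArithmeticFunction.liouville (N / (d * d)) := by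
  obtain ⟨q, s, hq0, hs0, hN', hq⟩ := Nat.sq_mul_squarefree_of_pos (Nat.pos_of_ne_zero hN)
  have hdiv : ∀ {m d : ℕ}, d ∣ m → q * m ^ 2 / (d * d) = q * (m / d) ^ 2 := by
    rintro m d ⟨k, rfl⟩
    rcases eq_or_ne d 0 with rfl | hd
    · simp
    · rw [Nat.mul_div_cancel_left k (Nat.pos_of_ne_zero hd),
        show q * (d * k) ^ 2 = d * d * (q * k ^ 2) by ring,
        Nat.mul_div_cancel_left _ (Nat.pos_of_ne_zero (mul_ne_zero hd hd))]
  have key : ∀ m > 0, ∑ i ∈ m.divisors, (fun k => (μ (q * k ^ 2) : ℤ)) i =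
      (fun k => (ArithmeticFunction.liouville (q * k ^ 2) : ℤ)) m := by
    intro m hm
    simp only
    rw [stub_lamOfMu (q * m ^ 2) (mul_ne_zero hq0.ne' (pow_ne_zero 2 hm.ne')),
      sqId_filter_sq_dvd_eq_divisors hq hm.ne',
      ← Nat.sum_div_divisors m (fun k => (μ (q * k ^ 2) : ℤ))]
    exact sum_congr rfl fun d hd => by rw [hdiv (Nat.dvd_of_mem_divisors hd)]
  have inv := ArithmeticFunction.sum_eq_iff_sum_mul_moebius_eq.mp key s hs0
  simp only [Int.cast_id] at inv
  rw [← hN', mul_comm (s ^ 2) q, ← inv, Nat.sum_divisorsAntidiagonal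
    (f := fun i j => (μ i : ℤ) * ArithmeticFunction.liouville (q * j ^ 2)),
    sqId_filter_sq_dvd_eq_divisors hq hs0.ne']
  exact sum_congr rfl fun d hd => by rw [hdiv (Nat.dvd_of_mem_divisors hd)]

/-- Tail of `∑ 1/d²`: for `1 ≤ D₀`, `∑_{D₀ < d ≤ K} 1/(d·d) ≤ 1/D₀` (telescoping
`1/d² ≤ 1/(d-1) - 1/d`). -/
theorem sqId_sum_Ioc_inv_mul_self_le (D₀ K : ℕ) (hD : 1 ≤ D₀) :
    ∑ d ∈ Ioc D₀ K, (1 : ℝ) / ((d : ℝ) * d) ≤ 1 / D₀ := by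
  suffices h : ∀ j : ℕ,
      ∑ d ∈ Ioc D₀ (D₀ + j), (1 : ℝ) / ((d : ℝ) * d) ≤ 1 / D₀ - 1 / ((D₀ : ℝ) + j) by
    rcases le_or_gt K D₀ with hK | hK
    · rw [Finset.Ioc_eq_empty (not_lt.mpr hK), sum_empty]
      positivity
    · obtain ⟨j, rfl⟩ := Nat.exists_eq_add_of_lt hK
      refine (h (j + 1)).trans ?_
      have : (0 : ℝ) ≤ 1 / ((D₀ : ℝ) + (j + 1 : ℕ)) := by positivity
      linarith
  intro j
  induction j with
  | zero => simp
  | succ j ih =>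
    rw [← add_assoc, sum_Ioc_succ_top (Nat.le_add_right D₀ j)]
    have hm : (1 : ℝ) ≤ (D₀ : ℝ) + j := by
      have : (1 : ℝ) ≤ D₀ := by exact_mod_cast hD
      have : (0 : ℝ) ≤ j := by positivity
      linarith
    have step : (1 : ℝ) / (((D₀ + j + 1 : ℕ) : ℝ) * ((D₀ + j + 1 : ℕ) : ℝ)) ≤
        1 / ((D₀ : ℝ) + j) - 1 / ((D₀ : ℝ) + ((j + 1 : ℕ) : ℝ)) := by
      push_cast
      rw [div_sub_div _ _ (by positivity) (by positivity),
        div_le_div_iff₀ (by positivity) (by positivity)]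
      nlinarith
    linarith

/-- **Tail count of large square divisors**: for `1 ≤ D₀`,
`∑_{N < 2ⁿ} #{d ∈ N.divisors : d·d ∣ N, D₀ < d} ≤ 2ⁿ / D₀`.  Swap the double count: each
`d ∈ (D₀, 2ⁿ]` is counted once for every positive multiple of `d·d` below `2ⁿ`, i.e. at most
`2ⁿ/(d·d)` times, and `∑_{d > D₀} 1/(d·d) ≤ 1/D₀` (`sqId_sum_Ioc_inv_mul_self_le`). -/
theorem stub_sqTail (n D₀ : ℕ) (hD : 1 ≤ D₀) : (∑ N ∈ Finset.range (2 ^ n), (((N.divisors.filter fun d => d * d ∣ N ∧ D₀ < d).card : ℕ) : ℝ)) ≤ (2 : ℝ) ^ n / D₀ := by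
  set M := 2 ^ n with hM
  -- Step 1 (in `ℕ`): swap the double count and count multiples of `d·d`.
  have h1 : ∑ N ∈ range M, (N.divisors.filter fun d => d * d ∣ N ∧ D₀ < d).card ≤
      ∑ d ∈ Ioc D₀ M, M / (d * d) := by
    calc ∑ N ∈ range M, (N.divisors.filter fun d => d * d ∣ N ∧ D₀ < d).card
        ≤ ∑ N ∈ range M, ((Ioc D₀ M).filter fun d => N ≠ 0 ∧ d * d ∣ N).card := by
          refine sum_le_sum fun N hN => card_le_card fun d hd => ?_
          simp only [mem_filter, Nat.mem_divisors, mem_Ioc] at hd ⊢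
          refine ⟨⟨hd.2.2, ?_⟩, hd.1.2, hd.2.1⟩
          exact (Nat.le_of_dvd (Nat.pos_of_ne_zero hd.1.2) hd.1.1).trans (mem_range.mp hN).le
      _ = ∑ d ∈ Ioc D₀ M, ((range M).filter fun N => N ≠ 0 ∧ d * d ∣ N).card := by
          simp only [card_filter]
          exact sum_comm
      _ ≤ ∑ d ∈ Ioc D₀ M, M / (d * d) := by
          refine sum_le_sum fun d _ => ?_
          rw [← Nat.Ioc_filter_dvd_card_eq_div M (d * d)]
          refine card_le_card fun N hN => ?_
          simp only [mem_filter, mem_range, mem_Ioc] at hN ⊢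
          exact ⟨⟨Nat.pos_of_ne_zero hN.2.1, hN.1.le⟩, hN.2.2⟩
  -- Step 2 (in `ℝ`): `∑_{D₀ < d ≤ M} M/(d·d) ≤ M/D₀`.
  have h2 : ((∑ d ∈ Ioc D₀ M, M / (d * d) : ℕ) : ℝ) ≤ (M : ℝ) * (1 / D₀) := by
    push_cast
    calc ∑ d ∈ Ioc D₀ M, (((M / (d * d) : ℕ)) : ℝ)
        ≤ ∑ d ∈ Ioc D₀ M, (M : ℝ) * (1 / ((d : ℝ) * d)) := by
          refine sum_le_sum fun d _ => ?_
          rw [mul_one_div, ← Nat.cast_mul]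
          exact Nat.cast_div_le
      _ = (M : ℝ) * ∑ d ∈ Ioc D₀ M, 1 / ((d : ℝ) * d) := by rw [mul_sum]
      _ ≤ (M : ℝ) * (1 / D₀) := by
          gcongr
          exact sqId_sum_Ioc_inv_mul_self_le D₀ M hD
  calc (∑ N ∈ range M, (((N.divisors.filter fun d => d * d ∣ N ∧ D₀ < d).card : ℕ) : ℝ))
      = ((∑ N ∈ range M, (N.divisors.filter fun d => d * d ∣ N ∧ D₀ < d).card : ℕ) : ℝ) := by
        push_cast
        rfl
    _ ≤ ((∑ d ∈ Ioc D₀ M, M / (d * d) : ℕ) : ℝ) := by exact_mod_cast h1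
    _ ≤ (M : ℝ) * (1 / D₀) := h2
    _ = (2 : ℝ) ^ n / D₀ := by rw [hM]; push_cast; ring

end Summit.QuantumAdvantage.QuantumAdvantage.Theorems.LiouvilleOrthogonalTC0
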